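import Mathlib
import Summits.NavierStokesRegularity.NavierStokesRegularity.Theorems.BarrierStepRungThreeCertificateNumerics
import HarnessLib

/-!
# DESIGN ONE of the window certificate: the profile kit's numeric side conditions, discharged
  (route `BarrierStepRungThree`)

Supports items stmt-NavierStokesRegularity-23420 / 23942.  The certificate template
`taoLadderRungThree_target_of_boxCertificateKit` (file `…CertificateTemplate.lean`) takes, besides the
box clauses, seven purely NUMERIC side conditions of the profile kit.  This file fixes the numbers of
the re-instanced design of record (ns-bsr3-p5 design sheet 01:15Z / 01:16Z, ns-bsr3-p3 squeeze memo;
MODEL lane) in the kernel-friendly variant `θ = 1/2` and proves all seven: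

* table: the trigger-chain pencil at `β = 1/100` (`A₀ = Aₓ = 1`, `A₁ = 101/100`, see
  `CertificateProfile.pencil_kit_sums`); clock `c = 2`; window `[kLo, kLo+n) = [-2, 4)` (`K = 4`,
  top window shell `3`);
* window-cap bounds `E_w = 1`, `E₀ = 2/5` (bottom shell `-2`), top cap `q_top = 1/10000`;
* lower profile `Q_b = 9/10`, `G = 2`, `λ = 3/4` (cap one shell behind the window `q_{-3} = 9/5`).

`designOne_numerics`: `hz` (`2cA₁ 2^{5K/2} q_top = 0.41… ≤ 1/2`), `hG8`, `hlam`, `hlamG`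
(`√2 ≤ 3/2`), `hgoal0` (`2 · 4/5 ≤ (27/20)²`), `hT1` (`≈ 0.079 ≤ 0.45`), `hT2` (`≈ 0.016 ≤ 1/4`), in
exactly the syntactic form the template asks for with these constants substituted.  With it, a
certificate writer for DESIGN ONE supplies only the window caps `Φ` (`Φ ≤ 1`, `Φ_{·,0} ≤ 2/5`,
`2Φ_{·,5} ≤ 10⁻⁸`), `Mw, η, Λ, δ, γ` and the five box clauses.

HONEST FRAMING: numeric bookkeeping for a certificate about a Tao-type MODEL lattice (rung TL-M3); it
constructs no certificate and proves nothing about any table's dynamics; nothing here concerns the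
Navier–Stokes equations; no summit is proved by this file.
-/

noncomputable section

-- the sub-problem namespace repeats the summit name by design (D-0017)
set_option linter.dupNamespace false

namespace Summit.NavierStokesRegularity.NavierStokesRegularity.Theorems

namespace CertificateProfile

/-- `√(4/5) < 0.8945`. [folklore] -/
theorem sqrt_four_fifths_lt : Real.sqrt (2 * (2 / 5)) < (0.8945 : ℝ) := by
  rw [show (0.8945 : ℝ) = Real.sqrt (0.8945 ^ 2) by rw [Real.sqrt_sq (by norm_num)]]
  exact Real.sqrt_lt_sqrt (by norm_num) (by norm_num)

/-- **DESIGN ONE: the profile kit's numeric side conditions hold** for `θ = 1/2`, `c = 2`,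
window `[-2, 4)`, pencil constants `A₀ = Aₓ = 1`, `A₁ = 101/100` (`β = 1/100`), `E₀ = 2/5`,
`q_top = 10⁻⁴`, `Q_b = 9/10`, `G = 2`, `λ = 3/4` — the hypotheses `hz`, `hG8`, `hlam`, `hlamG`,
`hgoal0`, `hT1`, `hT2` of `taoLadderRungThree_target_of_boxCertificateKit` verbatim with these
constants. [cite: Tao2016AveragedNS, §4 (4.8) (rates `(1+ε₀)^{5n/2}` at `ε₀ = 1`); numbers: MODEL-lane
design of record for route BarrierStepRungThree] -/
theorem designOne_numerics :
    (2 * (2 : ℝ) * (101 / 100) * (2 : ℝ) ^ ((5 : ℝ) * (((-2 : ℤ) + (6 : ℕ) : ℤ) : ℝ) / 2) * (1 / 10000) ≤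
        1 / 2) ∧
      ((2 : ℝ) ^ 2 < 8) ∧ ((3 / 4 : ℝ) < 1) ∧ ((2 : ℝ) ^ ((1 : ℝ) / 2) ≤ (3 / 4) * 2) ∧
      ((2 : ℝ) ^ (2 * ((1 : ℝ) / 2)) * (2 * (2 / 5)) ≤ ((3 / 4 : ℝ) * (9 / 10) * 2) ^ 2) ∧
      ((2 : ℝ) * ((2 : ℝ) ^ ((5 : ℝ) * (((-2 : ℤ) - 1 : ℤ) : ℝ) / 2) *
          (1 * ((9 / 10 : ℝ) * 2) ^ 2 + 1 * ((9 / 10 : ℝ) * 2) * Real.sqrt (2 * (2 / 5))) +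
          (2 : ℝ) ^ ((5 : ℝ) * (((-2 : ℤ) - 2 : ℤ) : ℝ) / 2) * ((101 / 100) * ((9 / 10 : ℝ) * 2 ^ 2) ^ 2)) ≤
        (1 - 3 / 4) * ((9 / 10 : ℝ) * 2)) ∧
      ((2 : ℝ) * (9 / 10) * (2 : ℝ) ^ ((5 : ℝ) * ((-2 : ℤ) : ℝ) / 2) *
          (2 * (2 : ℝ) ^ (-(5 : ℝ) / 2)) ^ 2 *
          (1 + 1 / 2 + (101 / 100) * (2 : ℝ) ^ 2 * (2 : ℝ) ^ (-(5 : ℝ) / 2)) ≤ 1 - 3 / 4) := by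
  have hs2 : Real.sqrt 2 < 1.41422 := sqrt_two_lt
  have hs2' : 0 < Real.sqrt 2 := Real.sqrt_pos.2 two_pos
  have hsq : Real.sqrt 2 * Real.sqrt 2 = 2 := Real.mul_self_sqrt zero_le_two
  have hs45 : Real.sqrt (2 * (2 / 5)) < 0.8945 := sqrt_four_fifths_lt
  have hs45' : 0 ≤ Real.sqrt (2 * (2 / 5)) := Real.sqrt_nonneg _
  refine ⟨?_, by norm_num, by norm_num, ?_, ?_, ?_, ?_⟩
  · -- hz: 2^{5·4/2} = 2^{10}
    rw [show (((-2 : ℤ) + (6 : ℕ) : ℤ) : ℝ) = ((4 : ℤ) : ℝ) by norm_num, two_rpow_five_halves_int,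
      show (5 * 4 : ℤ) = 2 * 10 by norm_num, sqrt_two_zpow_two_mul]
    norm_num
  · -- hlamG: √2 ≤ 3/2
    rw [two_rpow_half]; linarith
  · -- hgoal0
    rw [two_rpow_two_mul_half]; norm_num
  · -- hT1: rates 2^{-15/2} = 2^{-8} √2 and 2^{-10}
    rw [show (((-2 : ℤ) - 1 : ℤ) : ℝ) = ((-3 : ℤ) : ℝ) by norm_num,
      show (((-2 : ℤ) - 2 : ℤ) : ℝ) = ((-4 : ℤ) : ℝ) by norm_num, two_rpow_five_halves_int,
      two_rpow_five_halves_int, show (5 * (-3) : ℤ) = 2 * (-8) + 1 by norm_num,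
      sqrt_two_zpow_two_mul_add_one, show (5 * (-4) : ℤ) = 2 * (-10) by norm_num,
      sqrt_two_zpow_two_mul]
    have h8 : (2 : ℝ) ^ (-8 : ℤ) = 1 / 256 := by norm_num
    have h10 : (2 : ℝ) ^ (-10 : ℤ) = 1 / 1024 := by norm_num
    rw [h8, h10]
    nlinarith [mul_nonneg hs2'.le hs45', mul_le_mul hs2.le hs45.le hs45' (by norm_num : (0:ℝ) ≤ 1.41422)]
  · -- hT2: 2^{-5} and 2^{-5/2} = 2^{-3} √2
    rw [show (((-2 : ℤ)) : ℝ) = ((-2 : ℤ) : ℝ) by norm_num, two_rpow_five_halves_int,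
      show (5 * (-2) : ℤ) = 2 * (-5) by norm_num, sqrt_two_zpow_two_mul, two_rpow_neg_five_halves',
      show (-5 : ℤ) = 2 * (-3) + 1 by norm_num, sqrt_two_zpow_two_mul_add_one]
    have h5 : (2 : ℝ) ^ (2 * -3 + 1 : ℤ) = 1 / 32 := by norm_num
    have h3 : (2 : ℝ) ^ (-3 : ℤ) = 1 / 8 := by norm_num
    rw [h5, h3]
    nlinarith [hsq, hs2, hs2']

end CertificateProfile

end Summit.NavierStokesRegularity.NavierStokesRegularity.Theorems

end
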